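import Summits.QuantumFields.BalabanUV.T4Continuum.Support.ShellMeasureLandauEndAssembledDecayCfLin
import Summits.QuantumFields.BalabanUV.T4Continuum.Support.ShellMeasureLandauEndAssembledReachBlockP4Dim4
import Summits.QuantumFields.BalabanUV.T4Continuum.Support.ShellMeasureLandauEndAssembledDecayCfLinWitnessNumbers

/-!
# `T4Continuum.ShellMeasureLandauEndAssembledDecayCfLinWitness` — ROW S104 f3: RULE G-1 ∕ (x1) FOR THE LINEAR-CHART HOST WITH (P4) LIVE: S104 f2
# `ShellMeasureLandauEndAssembledDecayCfLin.slotAC_realized_su2_landauChart_assembled_decay_cfB7_lin` (the most-assembled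
# one-slot END with R11 AND R10 supplied — the host the ONE CALL v3 composes) FIRED BY NAME with EVERY binder supplied on
# leaf-03's corner datum, (T1) on the block field space (`hW := blockW_prop4Hyp`, non-zero propagator letter), the u-tuple's
# coarse-datum map the LINEAR `T := (E₀∕B₀)•id`, and EVERY number row rescaled against the tree's `C2cov d` ∕ `landauRad d L`
(cell `pub-balaban`, sub-cell `t4`, spine estimate NE7c (node U5b); NE7c ROUND-2 crew, unit
`b2b-balaban-t4-ne7c-formalise-leaf-02` gen 11; journal OFFER l.21457, owner GO R-ne7cp1-g36-6 (b) «ROW S104 f3», host author leaf-10-g13 «NOT MINE»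
l.21492; ADDITIVE — imports S104 f2 `…AssembledDecayCfLin` (leaf-10-g13;
through it S99 f3b∕f3a∕f1, S80 f6, [B7] Prop. 4's `C0 c2' O1cov C2cov landauRad landauCf`) and this lineage's S77 f8
`…AssembledReachBlockP4Dim4` (`sin_half_ge`; through `…ReachBlockP4`: `embOf`, `rdL_embOf_c₀`, `norm_embOf_le`, S80 f7's corner datum,
R10's `𝕐 𝕎 blockW blockW_prop4Hyp rdL 𝒢L rdL_solAt_eq_zero`) and the companion `…DecayCfLinWitnessNumbers` (OUR toy numbers `tS twS
α₀S ampT εθ₃` as closed terms in the tree's constants, the number rows, the window arithmetic) ONLY, ALL BY NAME; [folklore];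
0 `def`, 0 `def … : Prop`, 0 sorry, 0 citation tags)

HONEST FRAMING.  A CONSISTENCY CERTIFICATE (t4-ref2's rule G-1: a joint-inhabitation example for every END-level composition) for
OUR typed host; nothing about Bałaban's minimiser, propagators, kernels or densities.  Finite four-torus programme, rung (B)+1
only — NOT infinite volume, NOT a mass gap, NOT the Clay problem, NOT summit progress; NE7c (`T4IndicatorShell.ShellWeightBound`)
NOT PRINTED, NOT PROVED; «NE7c ⇐ the named binders» (c3); (M1) realized on a toy ≠ NE7c.  HONEST DEPENDENCY (cell): continuum
YM on T⁴ ⇐ BetaPertH ∧ nine spine estimates (0/9 proved); BetaPertH ⇐ (D1) ∧ (D4) ∧ CAP+tail; G-an2-4 gates asym, D1 and NE2/3/4.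

WHAT IS SUPPLIED AND HOW (every binder of the host, none left):
* γ3 side := leaf-03-g7's S80 f7 corner datum VERBATIM (`T := combBonds lo (lo+2)`, `Λ := {b₀}`, centre `1`, `toyU p₀`,
  `toyF7`, `toyJco7`, `readOut7`, `hcore_toy`∕`hcollar_toy`, cover `boxPlaqs ⊆ {p₀} ∪ boxPlaqs`).
* (T1) := R10's block space as in S77 f8: `𝒴 := 𝕐 d η`, `𝒵 := 𝕎 d`, `ℬ := Fin m₀ → ℂ`, **`W𝒱 := blockW d η`,
  `hW := blockW_prop4Hyp`** (`C₄ := C₄c d`, `a₃ := 1∕8`), `𝒢 := 𝒢L d η (B₀η∕2)` NON-ZERO (`rdL_solAt_eq_zero`), `H₁ :=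
  (B₀∕E₀)•embOf c₀ readOut7`, the u-tuple's coarse-datum map **`T V := (E₀∕B₀)•id` — a CLM, R10's displayed row `hTb :
  ‖T V‖·rΦ < 2dLC₁ε₁` MET** with `rΦ := tη∕384`; `𝔸 := ℂ`; the u-tuple's Landau letter is the host's own `C_k(1,·)` on the EMPTY
  stencil `Sf = Sf′ := ∅` with `ιs := 0`, `Hop := 0` (DEGENERATE — the live triple is S77 f8's); read-out `ℓs := [rdL]`.
* R11′∕R08p∕R22p rows: `k := j`, `Ubg := 1` (unitary), **`α₀ := α₀S d L = min (c2′∕4) (min (1∕(3C0)) (1∕(12·O1cov)))`** (`hα hα3 hα4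
  hα6` GENUINE inequalities between the tree's [B7] constants); `Sw = Sw′ = Se = Se′ := ∅`, so **`h52locw`∕`h52loce`∕`hreache` are
  VACUOUS** — the global minimiser's located regularity is NOT exercised (said again in the theorem's docstring).
* EVERY number row against `C2cov d`∕`landauRad d L`: u-tuple scale **`t := tS d L = min 1 (min (8∕(9(C2cov+1))) (16·landauRad∕3))`**
  (`ε₄ = t∕32`, `ε₁ = t(C₄c+1)∕64`, `ε₃ = t∕16`, `rΦ = tη∕384`: `h1 h2 h3 hcoup h18 h3R hTb`), w∕e-tuple letters
  **`ε₄w = bw = ε₄e = be := twS d L = min (1∕6) (min (landauRad∕12) (1∕(36(C2cov+1))))`** (`hdomw hqw hRCw hdome hqe hRCe hcoupE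
  hTbw hTbe`), amplitude `ampT` (the quadratic `C2cov` term INCLUDED), (SM) threshold `εθ₃` ((SM) an EQUALITY).
* (T2)∕(T3)∕(S78): S80 f4's degenerate-but-legal data (zero kernels on `Unit`∕empty index types, `β = 0`, `Tw = Te := 0`).
CONCLUSION: the host's (M1) for the toy slot with the CLEAN slot constant `4·m₀` (`slotAC_assembled_cfLin_blockP4`); symbolic `P`, `j`
(≥ 3 sites per direction), `lo`, `i₀ < i₁`, `e`, `d ≥ 2`, `0 < η ≤ 1`, `0 < S < tη∕384`, `0 ≤ ρ ≤ ¼`, `0 < a`,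
`(P.d−1)·2·a ≤ 2 sin(S∕2)`, `εθ₃·η² ≤ a`; and **`slotAC_assembled_cfLin_blockP4_dim4`**: every `P` with `P.d = 4`, `d = 4`, `η = ½`,
the EXPLICIT window `S = t²·¼∕10⁸`, `a = sin(S∕2)∕3`, `ρ = 1∕20` — NO hypothesis left.
HONEST ITEMS (owner R-ne7cp1-g36-6 (b)): (i) the w∕e-tuple located-regularity rows `h52locw`∕`h52loce` (and `hreache`) are NOT
exercised — empty stencils: a witness of JOINT INHABITATION of the binder SHAPES, not of the designed reading; (ii) `𝔸 := ℂ` — the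
C⋆-algebra instance in scope for the host's `[CStarAlgebra 𝔸]` (`CStarAlgebra (Matrix (Fin 2) (Fin 2) ℂ)` is NOT synthesised under
`Matrix.Norms.L2Operator` — probed on the farm), hence `Sf = Sf′ := ∅` and the u-tuple's Landau maps `ιs`∕`Hop` are `0` here (the
LIVE triple on `M₂`-valued letters is S77 f8's, for the `Cf`-free host S80 f6); (iii) census effect: NONE (a consistency certificate on
OUR typed objects).  WHAT THIS DOES NOT DO: exercise (T2)∕(T3) (C-t4r2-386 caveat (i) STANDS); compute a minimiser or a Landau
correction; discharge anything of Bałaban's.  NOTHING in the countdown moves.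
-/

noncomputable section

open Set Metric NormedSpace MeasureTheory Function

namespace Summit.QuantumFields.BalabanUV.T4Continuum.ShellMeasureLandauEndAssembledDecayCfLinWitness

open scoped ENNReal Matrix.Norms.L2Operator
open Literature.MathematicalPhysics.QuantumFieldTheory.Balaban1983to89
open B11Prop6Scheme (Prop4Hyp)
open B7Prop2Explicit (C0 c2' C0_pos c2'_pos unitaryUnits)
open T4ShellMeasure (SlotAntiConcentration)
open T4CubePoincare (cube mem_cube_iff)
open T4CubeChartGnomonic (SU2)
open T4AxialGaugeFixing (combBonds)
open T4AxialGaugeSmallField (boxPlaqs)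
open T4ExpWindowSmallField (dist1_eq_norm_coe_sub_one)
open T4ShellMeasurePlaquette (expTail₂)
open ShellMeasureLevelAssembly (classifier)
open ShellMeasureWilsonWords (wordExp wordExp_cons wordExp_nil)
open ShellMeasureLandauHolonomy (solAt landauExp)
open ShellMeasureLandauHolonomyChart (cplx holOf holOf_apply norm_cplx_le)
open ShellMeasureLandauHolonomySkew (readOutReal)
open ShellMeasureWilsonRealizedSU2 (M₂ gen coe_chart gen_mem_skewAdjoint)
open ShellMeasureLandauEndFinalToy (toyU measurable_toyU gaugeInvariant_toyU smul_mem_cube solAt_zero landauExp_zero)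
open ShellMeasureLandauEndAssembledToy (norm_kerOp_zero_le kerOp_zero_apply)
open ShellMeasureAverageProp4General (O1cov C2cov C1cov_pos O1cov_pos)
open ShellMeasureLandauCfPinned (C2cov_nonneg)
open ShellMeasureLandauCorrectionB7 (landauRad landauRad_pos)
open ShellMeasureLandauCorrectionReal (skewPi)
open ShellMeasureLandauEndAssembledDecayCfLin (slotAC_realized_su2_landauChart_assembled_decay_cfB7_lin)
open ShellMeasureLevelZeroBoxWitness (side_two_side side_two_nonwrapping)
open ShellMeasureLandauEndAssembledDecayReachToyData (b₀ p₀ readOut7 norm_readOut7_le readOut7_cplx singleton_box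
  singleton_comb plaqHol_p₀_sec)
open ShellMeasureLandauEndAssembledDecayReachToy (toyF7 toyJco7 measurable_toyF7 gaugeInvariant_toyF7 toyF7_le_one
  toyF7_section_mono hcore_toy hcollar_toy)
open ShellMeasureLandauEndBlockSpace (c₀ 𝕐 𝕎 blockW C₄c C₄c_nonneg blockW_prop4Hyp rdL 𝒢L rdL_𝒢L norm_rdL_le norm_𝒢L_le
  real_smul_mem_skewAdjoint)
open ShellMeasureLandauEndAssembledBlockP4 (rdL_solAt_eq_zero)
open ShellMeasureLandauEndAssembledReachBlockP4 (embOf rdL_embOf_c₀ norm_embOf_le)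


open ShellMeasureLandauEndAssembledDecayCfLinWitnessNumbers (tS twS α₀S ampT εθ₃ tS_pos tS_le_one twS_pos ampT_bounds α₀S_pos εθ₃_pos
  row_h3 row_fixedPoint row_h18 row_h3R row_we εθ₃_eta_sq_le)
open ShellMeasureLandauEndAssembledReachBlockP4Dim4 (sin_half_ge)

/-! ## THE LINEAR-CHART HOST FIRED BY NAME WITH EVERY BINDER SUPPLIED -/

section End
variable {P : Params} {j : ℕ} [DecidableEq (PBond P j)]

/-- **RULE G-1 ∕ (x1) FOR THE LINEAR-CHART HOST WITH (P4) LIVE.**  S104 f2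
`ShellMeasureLandauEndAssembledDecayCfLin.slotAC_realized_su2_landauChart_assembled_decay_cfB7_lin` APPLIED BY NAME with every
binder supplied: γ3 side := leaf-03's corner datum; (T1) := R10's block space (`hW := blockW_prop4Hyp`, `𝒢 := 𝒢L` non-zero,
`H₁ := (B₀∕E₀)•embOf c₀ readOut7`, LINEAR `T := (E₀∕B₀)•id` with `hTb` met, `𝔸 := ℂ`, `Sf = Sf′ := ∅`, `ιs = Hop := 0`);
`k := j`, `Ubg := 1`, `α₀ := α₀S P.d P.L` (the four α₀-rows GENUINE); `Sw = Sw′ = Se = Se′ := ∅` (located-regularity rows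
VACUOUS); every number row against `C2cov P.d`∕`landauRad P.d P.L` via `tS`∕`twS`; (T2)∕(T3)∕(S78) degenerate.  Conclusion:
the host's (M1), clean slot constant `4·m₀`.  A consistency certificate; nothing of Bałaban's; NE7c NOT PROVED. [folklore] -/
theorem slotAC_assembled_cfLin_blockP4 (lo : Fin P.d → ℤ) {i₀ i₁ : Fin P.d} (h01 : i₀ < i₁)
    (h3 : 3 ≤ P.sitesPerDir j) {m₀ : ℕ} (e : ↥({b₀ lo i₀ i₁} : Finset (PBond P j)) × Fin 3 ≃ Fin m₀)
    (d : ℕ) [NeZero d] (hd2 : 2 ≤ d) {η S ρ a : ℝ} (hη : 0 < η) (hη1 : η ≤ 1) (hS : 0 < S)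
    (hSr : S < tS P.d P.L * η / 384) (hρ0 : 0 ≤ ρ) (hρ4 : ρ ≤ 1 / 4) (ha : 0 < a)
    (hrad : ((P.d - 1 : ℕ) : ℝ) * (2 : ℕ) * a ≤ 2 * Real.sin (S / 2)) (hθa : εθ₃ d P.d P.L S η * η ^ 2 ≤ a) :
    SlotAntiConcentration ((fieldMeasure P j SU2).withDensity (toyF7 lo h01 a)) (toyU (p₀ lo i₀ i₁ h01))
      (εθ₃ d P.d P.L S η * η ^ 2) ρ (4 * m₀) := by
  have hd1 : 1 ≤ d := by omega
  have hd01 : (0 : Fin d) ≠ 1 := by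
    intro h
    have h' := congrArg Fin.val h
    rw [Fin.val_zero, Fin.val_one', Nat.mod_eq_of_lt (by omega)] at h'
    exact absurd h' (by norm_num)
  have hL1 : 1 ≤ P.L := P.hL.2.le
  have hN := side_two_nonwrapping (j := j) h3 lo
  have ht0 : 0 < tS P.d P.L := tS_pos hL1
  have ht1 : tS P.d P.L ≤ 1 := tS_le_one
  have hStη : S < η / 192 :=
    calc S < tS P.d P.L * η / 384 := hSr
      _ ≤ 1 * η / 384 := by gcongr
      _ ≤ η / 192 := by linarith
  have hSπ : 3 * S ^ 2 < Real.pi ^ 2 := by nlinarith [Real.pi_gt_three]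
  have htw0 : 0 < twS P.d P.L := twS_pos hL1
  obtain ⟨hdomw', hqw', hRCw', hqe', hRCe', hcoupE'⟩ := row_we (d' := P.d) hL1
  have hC := C₄c_nonneg d hd1
  obtain ⟨hdom', hself', hcontr'⟩ := row_fixedPoint hC ht0.le ht1
  have hs0 : 0 ≤ 1 / (C₄c d + 1) * η / 2 := by positivity
  have h𝒢B : ∀ f : 𝕎 d, ‖𝒢L d η (1 / (C₄c d + 1) * η / 2) f‖ ≤ 1 / (C₄c d + 1) * ‖f‖ := fun f =>
    (norm_𝒢L_le d hη hη1 hs0 f).trans (le_of_eq (by field_simp))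
  have hC1 : 0 < C₄c d + 1 := by linarith
  have hB₀ : 0 < 1 / (C₄c d + 1) := by positivity
  have hB₀1 : 1 / (C₄c d + 1) ≤ 1 := by rw [div_le_one hC1]; linarith
  have hR7 : ∀ y : Fin m₀ → ℂ, ‖readOut7 lo e y‖ ≤ 3 * ‖y‖ := fun y => norm_readOut7_le lo e y
  have hamp : (1 : ℝ) * ((tS P.d P.L / 32 + 1 / (C₄c d + 1) * (2 * 1 * 1 * (tS P.d P.L * (C₄c d + 1) / 64))) +
      1 / (C₄c d + 1) * (4 * C2cov P.d * (tS P.d P.L / 32 + 1 / (C₄c d + 1) *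
        (2 * 1 * 1 * (tS P.d P.L * (C₄c d + 1) / 64))) ^ 2)) = ampT d P.d P.L := by
    unfold ampT; field_simp; ring
  obtain ⟨hA0, hA1⟩ := ampT_bounds (d' := P.d) hd1 hL1
  have hα := α₀S_pos (d' := P.d) hL1
  -- the clean slot constant is read off the host's literal one by `∃ D, … ∧ D = 4·m₀`
  suffices key : ∃ D, SlotAntiConcentration ((fieldMeasure P j SU2).withDensity (toyF7 lo h01 a)) (toyU (p₀ lo i₀ i₁ h01))
      (εθ₃ d P.d P.L S η * η ^ 2) ρ D ∧ D = 4 * m₀ by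
    obtain ⟨D, hD, hD4⟩ := key; exact hD4 ▸ hD
  refine ⟨_, slotAC_realized_su2_landauChart_assembled_decay_cfB7_lin (P := P) (j := j) (n := Fin 2)
    (𝒴 := 𝕐 d η) (𝒵 := 𝕎 d) (ℬ := Fin m₀ → ℂ) (𝔸 := ℂ) (ι := Unit)
    (Pu := {()}) (δ := 1 / 2) (ρ := ρ) (β := 0) (B₀ := 1 / (C₄c d + 1)) (C₄ := C₄c d) (a₃ := 1 / 8) (ε₄ := tS P.d P.L / 32)
    (dL := 1) (C₁ := 1) (B₃ := 1) (ε₁ := tS P.d P.L * (C₄c d + 1) / 64) (rΦ := tS P.d P.L * η / 384) (α₀ := α₀S P.d P.L) (r₀e := 0)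
    (ε₃ := tS P.d P.L / 16) (κr := 1) (m := 1) (κc := 1)
    (Λw := Unit) (Λz := Unit) (Λb := Unit) (𝔖 := Unit) (𝔄w := ℂ) (ℭ := ℂ) (𝔇 := ℂ)
    (δw := 0) (c𝒢 := 0) (δ𝒢 := 0) (M𝒢 := 1) (cι := 0) (δι := 0) (Mι := 1) (cH := 0) (δH := 0)
    (MH := 1) (cH₁ := 0) (δH₁ := 0) (MH₁ := 1) (B₀w := 1) (C₄w := 0) (a₃w := 2 / 3) (ε₄w := twS P.d P.L) (bw := twS P.d P.L)
    (rΦw := 1) (rW := 0) (rC := 0) (𝔭 := Unit) (κwb := 1) (κcb := 1) (mw := 1)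
    (d := fun _ => 0) (dbar := 0) (Kw := 1) (Λe := Unit) (𝔄 := ℂ) (δ' := 0) (ϖ := fun _ => 0)
    (𝒵e := ℂ) (ℬe := ℂ) (B₀e := 1) (C₄e := 0) (a₃e := 2 / 3) (be := twS P.d P.L) (ε₄e := twS P.d P.L) (rΦe := 1)
    (𝔱 := Unit) (Ef := fun _ _ => 0) (rE := 1) (ee := fun _ => 0) (LK := 0) (BE₁ := 0) (Ω := Unit)
    (g := fun _ => 1) (Bd := 0) (BE₂ := 0) (η := η) (εθ := εθ₃ d P.d P.L S η) (c₁ := ampT d P.d P.L / η ^ 2)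
    (c₂ := ampT d P.d P.L / η) (z := 1)
    (a := a) (Pcore := ({p₀ lo i₀ i₁ h01} : Set (Plaq P j))) (Pcollar := boxPlaqs lo (fun κ => lo κ + 2)) (side_two_side lo)
    hN {b₀ lo i₀ i₁} (singleton_box hN h01) (singleton_comb hN h01) e hS hSπ (measurable_toyF7 lo h01 a)
    (gaugeInvariant_toyF7 lo h01 a) (measurable_toyU (p₀ lo i₀ i₁ h01)) (gaugeInvariant_toyU (p₀ lo i₀ i₁ h01))
    (Finset.singleton_nonempty ()) (fun _ => cube m₀ S) (toyJco7 lo h01 e S a)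
    -- (T1) on the block space
    (fun _ => 𝒢L d η (1 / (C₄c d + 1) * η / 2)) (fun _ => blockW d η) (fun _ f => h𝒢B f)
    (fun _ => blockW_prop4Hyp d hd1 hη hη1) hB₀ hC (by positivity)
    zero_le_one zero_le_one (by positivity) le_rfl ?_ ?_ (row_h3 hC ht0.le ht1)
    (fun _ => (((1 / (C₄c d + 1)) / (6 / η) : ℝ) : ℂ) • embOf d η (c₀ d) (readOut7 lo e)) ?_
    (fun _ => (((6 / η) / (1 / (C₄c d + 1)) : ℝ) : ℂ) • ContinuousLinearMap.id ℂ (Fin m₀ → ℂ)) ?_ hSr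
    -- R11′: level, stencils, background, α₀-rows, located regularity (vacuous), e-pins
    j ∅ ∅ ∅ ∅ ∅ ∅ (fun _ _ _ => 1) (fun _ _ _ => (unitaryUnits ℂ).one_mem) hα ?_ ?_ ?_
    (fun _ c => absurd c.2 (Finset.notMem_empty _)) (fun _ c => absurd c.2 (Finset.notMem_empty _))
    (fun _ => 0) (fun _ => 0) (fun _ => le_rfl) (fun _ => le_rfl) (fun c => absurd c.2 (Finset.notMem_empty _))
    -- the u-tuple's Landau maps (degenerate on the empty stencil) and the number rows `h18 hcoup h3R`
    (fun _ => 0) (fun _ Y => by rw [zero_apply, norm_zero]; exact norm_nonneg _) (fun _ => 0)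
    (fun _ X => by rw [zero_apply, norm_zero]; exact mul_nonneg hB₀.le (norm_nonneg X)) (row_h18 hL1 hB₀1) ?_ row_h3R
    (fun _ => [rdL d η]) zero_le_one
    (fun _ _ ℓ hℓ Y => by rw [List.mem_singleton.1 hℓ, one_mul]; exact norm_rdL_le d η Y)
    (fun _ _ => by simp) zero_le_one
    (fun _ _ Y => by simpa using norm_rdL_le d η Y)
    -- (T2): degenerate-but-legal data, letters `twS P.d P.L`
    le_rfl (fun _ => 0) (fun _ _ => 0)
    (fun _ _ => by simp) id id (fun _ => ()) (fun _ => ()) id (fun _ _ _ => 0) (fun _ _ _ => 0) (fun _ _ _ => 0)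
    (fun _ _ _ => 0) le_rfl
    zero_le_one (fun _ _ _ => by simp) (fun _ => by simp) le_rfl zero_le_one (fun _ _ _ => by simp)
    (fun _ => by simp) le_rfl zero_le_one (fun _ _ _ => by simp) (fun _ => by simp) le_rfl zero_le_one
    (fun _ _ _ => by simp) (fun _ => by simp) (fun _ _ => 0) (fun _ f => norm_kerOp_zero_le zero_le_one f)
    (fun _ => ⟨fun Y _ => by simp, differentiableOn_const _⟩) one_pos le_rfl htw0.le hdomw'
    (by rw [mul_zero, zero_mul]; exact htw0.le) (by norm_num) (fun _ B => norm_kerOp_zero_le zero_le_one B)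
    (fun _ => 0) ?_ (by linarith)
    (fun _ Y => by simpa using norm_kerOp_zero_le zero_le_one Y) (fun _ X => norm_kerOp_zero_le zero_le_one X)
    hqw' hRCw' (fun _ _ => True) (fun _ A A' c' _ => rfl) (fun _ _ _ => by simp)
    (fun c' => absurd c'.2 (Finset.notMem_empty _)) (fun _ z i _ => rfl) (by norm_num) (by simp) {()}
    (fun _ => [0]) (fun _ => ∅) (fun _ => 0) (fun _ _ ℓ _ A A' _ => by simp_all)
    (fun _ _ b' hb' => absurd hb' (Finset.notMem_empty _)) (fun _ _ => le_rfl) zero_le_one zero_le_one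
    (fun _ _ ℓ hℓ => by rw [List.mem_singleton.1 hℓ]; exact ContinuousLinearMap.opNorm_le_bound _ zero_le_one fun Y => by simp)
    (fun _ _ => by
      rw [List.sum_cons, List.sum_nil, add_zero]
      exact ContinuousLinearMap.opNorm_le_bound _ zero_le_one fun Y => by simp)
    (fun _ _ => by simp) ⊤ (by simp) ⊤ ⊤ (fun _ f _ => AddSubgroup.mem_top _)
    (fun _ Y _ => AddSubgroup.mem_top _) (fun _ Y _ => by rw [kerOp_zero_apply]; exact AddSubgroup.zero_mem _)
    (fun _ X _ => AddSubgroup.mem_top _) (fun _ B _ => AddSubgroup.mem_top _) (fun _ y => AddSubgroup.mem_top _)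
    (fun _ _ ℓ hℓ Y _ => by rw [List.mem_singleton.1 hℓ]; simp) (fun _ _ => 1) (fun _ _ _ => (unitary _).one_mem)
    (fun _ _ _ => by simp) (fun _ _ => le_rfl) le_rfl (by simp)
    -- (T3): degenerate data, letters `twS P.d P.L`
    le_rfl (fun _ => le_rfl) (fun _ => 0) (fun _ _ => 0)
    (fun _ f => by simp) (fun _ => ⟨fun Y _ => by simp, differentiableOn_const _⟩) one_pos le_rfl htw0.le htw0.le
    hdomw' (by rw [mul_zero, zero_mul]; exact htw0.le) (by norm_num) (fun _ => 0) (fun _ B => by simp)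
    (fun _ => 0) ?_ (by linarith)
    (fun _ => 0) (fun _ Y => by simp) (fun _ => 0) (fun _ X => by simp) hqe' hRCe' {()} one_pos
    (fun _ _ => differentiableOn_const _) (fun _ _ Z _ => by simp) (fun _ _ => le_rfl) (fun _ => ∅)
    (fun _ _ A₁ A₂ _ => rfl) (fun _ => 0) (fun _ _ b' hb' => absurd hb' (Finset.notMem_empty _)) le_rfl (by simp) hcoupE'
    (fun _ y _ => by simp)
    -- (S78)
    (Measure.dirac ()) (fun _ => zero_le_one) (fun _ _ _ => 0) le_rfl (fun _ x _ c' _ _ => by simp)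
    (fun _ x _ c' _ _ => by simp) (fun _ x _ c' _ _ ω => by simp) (fun _ y _ => by simp)
    -- real structure and dictionary through the block space
    {rdL d η} ⊤ (readOutReal {readOut7 lo e})
    (fun _ f _ => ?_) (fun _ Y _ => AddSubgroup.mem_top _)
    (fun _ Y _ => by rw [zero_apply]; exact AddSubgroup.zero_mem _) (fun _ X _ => by simp)
    (fun _ B hB => ?_) (fun _ y => ?_) (fun V x hx => ?_) (fun V x hxu => ?_)
    (fun V x hJ => ?_) (fun V x t' ht' => ?_) (fun V x => ?_)
    (fun _ => ShellMeasureLandauHolonomyPrint.chartCube_subset_closedBall hS.le)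
    (by norm_num) (by norm_num) hρ0 (by linarith) le_rfl hη (εθ₃_pos hd1 hL1 hS hη hSr) ?_ ?_ ?_ ?_
    ha.le hrad (fun q hq => Or.inr hq) (hcore_toy lo h01 hθa) (hcollar_toy lo h01 hN ha), ?_⟩
  · -- `h1`: `2·B₀·C₁·B₃·ε₁ ≤ ε₄` — equality `tS P.d P.L∕32`
    rw [show 2 * (1 / (C₄c d + 1)) * 1 * 1 * (tS P.d P.L * (C₄c d + 1) / 64) = tS P.d P.L / 32 by field_simp; ring]
  · -- `h2`: `4ε₄ ≤ a₃`
    rw [show 4 * (tS P.d P.L / 32) = tS P.d P.L / 8 by ring]; linarith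
  · -- `hH₁`: `‖(B₀∕E₀)•embOf c₀ R B‖ ≤ B₀‖B‖`
    intro V B
    rw [smul_apply, norm_smul, Complex.norm_real, Real.norm_of_nonneg (by positivity)]
    calc (1 / (C₄c d + 1)) / (6 / η) * ‖embOf d η (c₀ d) (readOut7 lo e) B‖
        ≤ (1 / (C₄c d + 1)) / (6 / η) * (2 / η * (3 * ‖B‖)) :=
          mul_le_mul_of_nonneg_left (norm_embOf_le d hη hη1 (c₀ d) (readOut7 lo e) (by norm_num) hR7 B) (by positivity)
      _ = 1 / (C₄c d + 1) * ‖B‖ := by field_simp; ring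
  · -- `hTb`: `‖(E₀∕B₀)•id‖·(tS P.d P.Lη∕384) < 2dLC₁ε₁ = tS P.d P.L(C₄c d+1)∕32` (R10's displayed number relation, met)
    intro V
    have hT : ‖(((6 / η) / (1 / (C₄c d + 1)) : ℝ) : ℂ) • ContinuousLinearMap.id ℂ (Fin m₀ → ℂ)‖ ≤ (6 / η) / (1 / (C₄c d + 1)) := by
      rw [norm_smul, Complex.norm_real, Real.norm_of_nonneg (by positivity)]
      exact mul_le_of_le_one_right (by positivity) ContinuousLinearMap.norm_id_le
    calc ‖(((6 / η) / (1 / (C₄c d + 1)) : ℝ) : ℂ) • ContinuousLinearMap.id ℂ (Fin m₀ → ℂ)‖ * (tS P.d P.L * η / 384)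
        ≤ (6 / η) / (1 / (C₄c d + 1)) * (tS P.d P.L * η / 384) := mul_le_mul_of_nonneg_right hT (by positivity)
      _ = tS P.d P.L * (C₄c d + 1) / 64 := by field_simp; ring
      _ < 2 * 1 * 1 * (tS P.d P.L * (C₄c d + 1) / 64) := by
          have := mul_pos ht0 hC1; linarith
  · -- `hα3`: `C0·α₀ ≤ 1∕3`
    have h0 := C0_pos P.d
    calc C0 P.d * α₀S P.d P.L ≤ C0 P.d * (1 / (3 * C0 P.d)) :=
          mul_le_mul_of_nonneg_left ((min_le_right _ _).trans (min_le_left _ _)) h0.le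
      _ = 1 / 3 := by field_simp
  · -- `hα4`: `4α₀ ≤ c2′`
    have : α₀S P.d P.L ≤ c2' P.d P.L / 4 := min_le_left _ _
    linarith
  · -- `hα6`: `4·O1cov·α₀ ≤ 1∕3`
    have h0 := O1cov_pos P.d
    calc 4 * O1cov P.d * α₀S P.d P.L ≤ 4 * O1cov P.d * (1 / (12 * O1cov P.d)) :=
          mul_le_mul_of_nonneg_left ((min_le_right _ _).trans (min_le_right _ _)) (by positivity)
      _ = 1 / 3 := by field_simp; ring
  · -- `hcoup`: `ε₄ + B₀·(2dLC₁ε₁) ≤ ε₃` — equality `tS P.d P.L∕16`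
    rw [show tS P.d P.L / 32 + 1 / (C₄c d + 1) * (2 * 1 * 1 * (tS P.d P.L * (C₄c d + 1) / 64)) = tS P.d P.L / 16 by field_simp; ring]
  · -- `hTbw`: `‖0‖·rΦw < bw`
    intro V; rw [norm_zero, zero_mul]; exact htw0
  · -- `hTbe`
    intro V; rw [norm_zero, zero_mul]; exact htw0
  · -- `h𝒢r`: the read-out never sees the propagator letter
    intro ℓ hℓ
    rw [Set.mem_singleton_iff.1 hℓ, rdL_𝒢L d hd01]
    exact (skewAdjoint M₂).zero_mem
  · -- `hH₁r`
    intro ℓ hℓ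
    rw [Set.mem_singleton_iff.1 hℓ, smul_apply, map_smul, rdL_embOf_c₀]
    exact real_smul_mem_skewAdjoint (hB (readOut7 lo e) (Set.mem_singleton _)) _
  · -- `hTr`: `T V (cplx y)` is read skew-adjoint by leaf-03's letter
    intro ℓ hℓ
    rw [Set.mem_singleton_iff.1 hℓ, smul_apply, ContinuousLinearMap.coe_id', id, map_smul, readOut7_cplx]
    exact real_smul_mem_skewAdjoint (gen_mem_skewAdjoint _ _ _ _) _
  · -- `hRdict`
    rw [toyJco7, indicator_of_mem hx]
    simp
  · -- `hudict`: leaf-03's dictionary READ THROUGH THE BLOCK SPACE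
    have hsc : ((((1 / (C₄c d + 1)) / (6 / η) : ℝ) : ℂ) • embOf d η (c₀ d) (readOut7 lo e))
        (((((6 / η) / (1 / (C₄c d + 1)) : ℝ) : ℂ) • ContinuousLinearMap.id ℂ (Fin m₀ → ℂ)) (cplx x)) =
        embOf d η (c₀ d) (readOut7 lo e) (cplx x) := by
      rw [smul_apply, smul_apply, ContinuousLinearMap.coe_id', id, map_smul, smul_smul, ← Complex.ofReal_mul,
        show (1 / (C₄c d + 1)) / (6 / η) * ((6 / η) / (1 / (C₄c d + 1))) = (1 : ℝ) by field_simp, Complex.ofReal_one,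
        one_smul]
    have hxS : ‖x‖ ≤ S :=
      mem_closedBall_zero_iff.1 (ShellMeasureLandauHolonomyPrint.chartCube_subset_closedBall hS.le hxu)
    have h𝔄 : ‖embOf d η (c₀ d) (readOut7 lo e) (cplx x)‖ < tS P.d P.L / 64 :=
      calc ‖embOf d η (c₀ d) (readOut7 lo e) (cplx x)‖ ≤ 2 / η * (3 * ‖cplx x‖) :=
            norm_embOf_le d hη hη1 (c₀ d) (readOut7 lo e) (by norm_num) hR7 _
        _ = 6 / η * ‖cplx x‖ := by ring
        _ ≤ 6 / η * S := mul_le_mul_of_nonneg_left ((norm_cplx_le x).trans hxS) (by positivity)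
        _ < 6 / η * (tS P.d P.L * η / 384) := mul_lt_mul_of_pos_left hSr (by positivity)
        _ = tS P.d P.L / 64 := by field_simp; ring
    have hsol : rdL d η (solAt (𝒢L d η (1 / (C₄c d + 1) * η / 2)) 0 (blockW d η) (tS P.d P.L / 32) (0 : 𝕎 d)
        (embOf d η (c₀ d) (readOut7 lo e) (cplx x))) = 0 :=
      rdL_solAt_eq_zero d hd01 h𝒢B (blockW_prop4Hyp d hd1 hη hη1) hB₀.le hC h𝔄 (by positivity) hdom' hself' hcontr'
    rw [toyU, plaqHol_p₀_sec hN h01, dist1_eq_norm_coe_sub_one, coe_chart]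
    simp only [classifier, Finset.sup'_singleton, holOf_apply, List.map_cons, List.map_nil, wordExp_cons, wordExp_nil,
      mul_one, landauExp_zero, hsc, map_add, hsol, zero_add, rdL_embOf_c₀, readOut7_cplx]
  · -- `hJW`
    by_contra h
    exact hJ (indicator_of_notMem h _)
  · -- `hJ`
    unfold toyJco7
    by_cases hx : x ∈ cube m₀ S
    · rw [indicator_of_mem hx, indicator_of_mem (smul_mem_cube hx ht')]
      exact toyF7_section_mono lo h01 hN hSπ e a V hx ht'
    · rw [indicator_of_notMem hx]; exact bot_le
  · -- `hJ1`
    unfold toyJco7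
    by_cases hx : x ∈ cube m₀ S
    · rw [indicator_of_mem hx]; exact toyF7_le_one lo h01 a _
    · rw [indicator_of_notMem hx]; exact bot_le
  · -- `hs₁`
    rw [hamp, show ampT d P.d P.L / η ^ 2 * η ^ 2 * 1 = ampT d P.d P.L by field_simp]
  · -- `ha`
    rw [hamp, show ampT d P.d P.L / η * η * 1 = ampT d P.d P.L by field_simp]
  · -- `hma`
    rw [hamp, Nat.cast_one, one_mul]; linarith
  · -- `hsm`: (SM) with equality
    unfold εθ₃
    rw [show (1 : ℝ) / 2 * (72 * (ampT d P.d P.L / η ^ 2 * 1 + ((1 : ℕ) : ℝ) ^ 2 * (ampT d P.d P.L / η) ^ 2 * 1 ^ 2) /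
        ((tS P.d P.L * η / 384) / S - 1) ^ 2) = 36 * (ampT d P.d P.L / η ^ 2 * 1 + ((1 : ℕ) : ℝ) ^ 2 *
        (ampT d P.d P.L / η) ^ 2 * 1 ^ 2) / ((tS P.d P.L * η / 384) / S - 1) ^ 2 by ring]
  · -- the clean slot constant
    simp only [abs_zero, zero_mul, mul_zero, zero_div, zero_add, add_zero]
    ring

/-- **THE FOUR-DIMENSIONAL INSTANCE — NO HYPOTHESIS LEFT.**  Every lattice `P` with `P.d = 4`, level `j` with ≥ 3 sites per
direction, corner `lo`, `i₀ < i₁`, `e`; block dimension `d = 4`, `η = ½`, the EXPLICIT window `S = t²·¼∕10⁸` (`t = tS 4 P.L`),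
core radius `a = sin(S∕2)∕3`, threshold `εθ₃·¼ ≤ S∕12 ≤ a`, depth `ρ = 1∕20`. [folklore] -/
theorem slotAC_assembled_cfLin_blockP4_dim4 (hP : P.d = 4) (lo : Fin P.d → ℤ) {i₀ i₁ : Fin P.d} (h01 : i₀ < i₁)
    (h3 : 3 ≤ P.sitesPerDir j) {m₀ : ℕ} (e : ↥({b₀ lo i₀ i₁} : Finset (PBond P j)) × Fin 3 ≃ Fin m₀) :
    SlotAntiConcentration ((fieldMeasure P j SU2).withDensity
        (toyF7 lo h01 (Real.sin ((tS P.d P.L ^ 2 * (1 / 2 : ℝ) ^ 2 / 10 ^ 8) / 2) / 3))) (toyU (p₀ lo i₀ i₁ h01))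
      (εθ₃ 4 P.d P.L (tS P.d P.L ^ 2 * (1 / 2 : ℝ) ^ 2 / 10 ^ 8) (1 / 2) * (1 / 2) ^ 2) (1 / 20) (4 * m₀) := by
  have hL1 : 1 ≤ P.L := P.hL.2.le
  have ht0 : 0 < tS P.d P.L := tS_pos hL1
  have ht1 : tS P.d P.L ≤ 1 := tS_le_one
  have hS : (0 : ℝ) < tS P.d P.L ^ 2 * (1 / 2 : ℝ) ^ 2 / 10 ^ 8 := by positivity
  have hS2 : tS P.d P.L ^ 2 * (1 / 2 : ℝ) ^ 2 / 10 ^ 8 ≤ 2 := by nlinarith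
  have hSr : tS P.d P.L ^ 2 * (1 / 2 : ℝ) ^ 2 / 10 ^ 8 < tS P.d P.L * (1 / 2) / 384 := by nlinarith
  have hsin := sin_half_ge hS.le hS2
  have ha : 0 < Real.sin ((tS P.d P.L ^ 2 * (1 / 2 : ℝ) ^ 2 / 10 ^ 8) / 2) / 3 := by linarith
  have hrad : ((P.d - 1 : ℕ) : ℝ) * (2 : ℕ) * (Real.sin ((tS P.d P.L ^ 2 * (1 / 2 : ℝ) ^ 2 / 10 ^ 8) / 2) / 3) ≤
      2 * Real.sin ((tS P.d P.L ^ 2 * (1 / 2 : ℝ) ^ 2 / 10 ^ 8) / 2) := by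
    rw [hP]; norm_num; linarith
  have hθ := (εθ₃_eta_sq_le (d := 4) (d' := P.d) (L := P.L) (by norm_num) hL1 (η := 1 / 2) (by norm_num) (by norm_num) hS
    le_rfl).trans (by linarith : (tS P.d P.L ^ 2 * (1 / 2 : ℝ) ^ 2 / 10 ^ 8) / 12 ≤
      Real.sin ((tS P.d P.L ^ 2 * (1 / 2 : ℝ) ^ 2 / 10 ^ 8) / 2) / 3)
  exact slotAC_assembled_cfLin_blockP4 lo h01 h3 e 4 (by norm_num) (by norm_num) (by norm_num) hS hSr (by norm_num)
    (by norm_num) ha hrad hθ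

end End

end Summit.QuantumFields.BalabanUV.T4Continuum.ShellMeasureLandauEndAssembledDecayCfLinWitness

end
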